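import Summits.NavierStokesRegularity.NavierStokesRegularity.Theorems.TargetDepletionLadderStubDepletionBelowHalfByName
import Summits.NavierStokesRegularity.NavierStokesRegularity.Theses.TypeICertificateLadder
import HarnessLib

/-!
# Crux `Target` (stmt-NavierStokesRegularity-1217), line `depletion_ladder` (skeleton `Cruxes/Target/Lines/depletion_ladder.lean`,
# sha16 `f7213e70113b3d52`): the ladder's CERTIFIED REACH after S1 + S2, and the residual S3 re-read against it

`--supports stmt-NavierStokesRegularity-1217` (seat leafhand-ns-poloidalwindowdoor-3 g1, cell decomp-ns, 2026-08-31).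
**Bookkeeping over landed theorems; closes no stub; the crux `Target` (no Type-I blow-up) and NS regularity remain OPEN.**

With S1 `stub_depletionBelowHalf` closed at the witness `κ = (2+√3)/9` (p820598, `…StubDepletionBelowHalfByName.stretchingDepletion_sharp`)
and S2 `stub_rung_of_depletion` (p814268: a depletion constant `κ` closes every rung `X_C` with `κ·C < 1`), the amplitude ladder of route
`TypeICertificateLadder` is certified up to the level

  `C⋆ = 9/(2+√3) = 18 − 9√3 = 2.4115…`  (`reach_eq`, `two_lt_reach`, `reach_lt_five_halves`):

* `rung_of_lt_reach` — ★ `Rung C` for EVERY `0 < C < 18 − 9√3` (over the twinned `Skeleton.Rung` of p814268): an eventual dimensionless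
  rate `√(T−t)‖u(t,x)‖ ≤ C√ν`, `C < 2.4115…`, for a classical Leray–Hopf rapidly-decaying-datum solution of unforced Navier–Stokes on
  `ℝ³ × [0,T)` forces a smooth extension past `T`; `hasSmoothExtensionPast_of_rate_lt_reach` is the same with `Rung` unfolded.  This strictly
  contains the skeleton's node RUNG TWO (`rung_two`, `stub_rungTwo` p538781) and the older kernel reach `C < √6 − √2` of the `L^q`-budget rungs.
* `descentToRungTwo_below_reach` — the registered residual S3 `DescentToRungTwo` («a non-extending Type-I(`C`) solution eventually has rate
  `≤ 2√ν`») is VACUOUSLY TRUE at every level `C < 18 − 9√3` (such solutions extend): the content of S3 starts at `C ≥ 18 − 9√3`.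
* `noTypeIBlowup_of_descent_below_reach` / `noTypeIBlowup_iff_descent_below_reach` — the crux BY NAME (`Theses.TypeICertificateLadder.NoTypeIBlowup`)
  is EQUIVALENT to «descent from every level to SOME level below the reach»: a non-extending Type-I(`C`) solution eventually has rate
  `≤ C'√ν` for some `C' < 18 − 9√3` (the skeleton's `noTypeIBlowup_iff_rungTwo_and_descent` with the target level raised from `2` to the
  certified reach; every future improvement of the depletion constant `κ` raises it to `1/κ` through `stub_rung_of_depletion` verbatim).

HONEST LABEL: corollaries of p820598 + p814268 + `LadderGlue_holds`; no new analysis; the numerics of the line (kit j021500/j021517: no field found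
above `R = 0.144`) suggest the true depletion constant is far below `(2+√3)/9`, i.e. the certified reach is not the method's limit, but the
crux needs ALL levels (the descent), which is the open Type-I Liouville content. [folklore]
-/

noncomputable section

-- the summit and its single sub-problem share the name (CONVENTIONS §1)
set_option linter.dupNamespace false

open Set Filter Topology MeasureTheory
open scoped RealInnerProductSpace
open Literature.Analysis.FluidPDE

namespace Summit.NavierStokesRegularity.NavierStokesRegularity.Theorems.DepletionLadder.Reach

open Summit.NavierStokesRegularity.NavierStokesRegularity.Theorems.DepletionLadder.Skeleton
open Summit.NavierStokesRegularity.NavierStokesRegularity.Theses.TypeICertificateLadder (NoTypeIBlowup LadderGlue_holds)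

/-! ## The number `C⋆ = 9/(2+√3) = 18 − 9√3 ∈ (2, 5/2)` -/

/-- `9/(2+√3) = 18 − 9√3` (rationalised reciprocal of the depletion constant `(2+√3)/9`). [folklore] -/
theorem reach_eq : (9 : ℝ) / (2 + Real.sqrt 3) = 18 - 9 * Real.sqrt 3 := by
  have hs : Real.sqrt 3 * Real.sqrt 3 = 3 := Real.mul_self_sqrt (by norm_num)
  have hpos : (0 : ℝ) < 2 + Real.sqrt 3 := by positivity
  rw [div_eq_iff hpos.ne']
  nlinarith [hs]

/-- The depletion constant times the reach is exactly one: `((2+√3)/9)·(18 − 9√3) = 1`. [folklore] -/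
theorem sharp_mul_reach : (2 + Real.sqrt 3) / 9 * (18 - 9 * Real.sqrt 3) = 1 := by
  have hs : Real.sqrt 3 * Real.sqrt 3 = 3 := Real.mul_self_sqrt (by norm_num)
  have h : (2 + Real.sqrt 3) / 9 * (18 - 9 * Real.sqrt 3) = 4 - Real.sqrt 3 * Real.sqrt 3 := by ring
  rw [h, hs]; norm_num

/-- The certified reach exceeds rung two: `2 < 18 − 9√3` (`√3 < 16/9`). [folklore] -/
theorem two_lt_reach : (2 : ℝ) < 18 - 9 * Real.sqrt 3 := by
  have h : Real.sqrt 3 < 16 / 9 := (Real.sqrt_lt' (by norm_num)).2 (by norm_num)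
  linarith

/-- … and stays below `5/2`: `18 − 9√3 < 5/2` (`31/18 < √3`). [folklore] -/
theorem reach_lt_five_halves : 18 - 9 * Real.sqrt 3 < (5 : ℝ) / 2 := by
  have h : (31 : ℝ) / 18 < Real.sqrt 3 := (Real.lt_sqrt (by norm_num)).2 (by norm_num)
  linarith

/-! ## The certified rungs -/

/-- ★ **Every rung below the reach is certified: `Rung C` for `0 < C < 18 − 9√3 = 9/(2+√3)`** — S2 (`stub_rung_of_depletion`, p814268) at the
S1 witness `κ = (2+√3)/9` (`stretchingDepletion_sharp`, p820598), since `κ·C < κ·(18 − 9√3) = 1`. [folklore] -/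
theorem rung_of_lt_reach (C : ℝ) (hC : 0 < C) (hCr : C < 18 - 9 * Real.sqrt 3) : Rung C := by
  have hκ : 0 < (2 + Real.sqrt 3) / 9 := by positivity
  have hκC : (2 + Real.sqrt 3) / 9 * C < 1 := by
    have h := mul_lt_mul_of_pos_left hCr hκ
    rwa [sharp_mul_reach] at h
  exact stub_rung_of_depletion _ hκ stretchingDepletion_sharp C hC hκC

/-- **The same with `Rung` unfolded**: a classical Leray–Hopf rapidly-decaying-datum solution of unforced Navier–Stokes on `ℝ³ × [0,T)` whose
eventual dimensionless rate is `√(T−t)‖u(t,x)‖ ≤ C√ν` with `0 < C < 18 − 9√3` extends smoothly past `T`. [folklore] -/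
theorem hasSmoothExtensionPast_of_rate_lt_reach (C : ℝ) (hC : 0 < C) (hCr : C < 18 - 9 * Real.sqrt 3)
    (ν T : ℝ) (hν : 0 < ν) (hT : 0 < T) (u : ℝ → EuclideanSpace ℝ (Fin 3) → EuclideanSpace ℝ (Fin 3))
    (p : ℝ → EuclideanSpace ℝ (Fin 3) → ℝ) (hcl : IsClassicalNSSolutionOn (Set.Ico 0 T) ν 0 u p)
    (hLH : IsLerayHopfOn T ν 0 (u 0) u) (hdec : HasRapidSpatialDecay (u 0))
    (hrate : ∀ᶠ t in 𝓝[<] T, ∀ x, Real.sqrt (T - t) * ‖u t x‖ ≤ C * Real.sqrt ν) :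
    HasSmoothExtensionPast ν 0 u T :=
  rung_of_lt_reach C hC hCr ν T hν hT u p hcl hLH hdec hrate

/-! ## The residual S3 against the reach -/

/-- **S3 is vacuous below the reach.**  The body of the registered residual `DescentToRungTwo` («a Type-I(`C`) solution that does NOT
extend past `T` eventually has rate `≤ 2√ν`») holds at every level `0 < C < 18 − 9√3`, because such a solution extends
(`rung_of_lt_reach`); the content of S3 therefore begins at `C ≥ 18 − 9√3`. [folklore] -/
theorem descentToRungTwo_below_reach (C : ℝ) (hC : 0 < C) (hCr : C < 18 - 9 * Real.sqrt 3)
    (ν T : ℝ) (hν : 0 < ν) (hT : 0 < T) (u : ℝ → EuclideanSpace ℝ (Fin 3) → EuclideanSpace ℝ (Fin 3))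
    (p : ℝ → EuclideanSpace ℝ (Fin 3) → ℝ) (hcl : IsClassicalNSSolutionOn (Set.Ico 0 T) ν 0 u p)
    (hLH : IsLerayHopfOn T ν 0 (u 0) u) (hdec : HasRapidSpatialDecay (u 0))
    (hrate : ∀ᶠ t in 𝓝[<] T, ∀ x, Real.sqrt (T - t) * ‖u t x‖ ≤ C * Real.sqrt ν)
    (hext : ¬ HasSmoothExtensionPast ν 0 u T) :
    ∀ᶠ t in 𝓝[<] T, ∀ x, Real.sqrt (T - t) * ‖u t x‖ ≤ 2 * Real.sqrt ν :=
  absurd (rung_of_lt_reach C hC hCr ν T hν hT u p hcl hLH hdec hrate) hext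

/-- ★ **The crux BY NAME from descent below the reach.**  If every classical Leray–Hopf rapidly-decaying-datum solution with an eventual
Type-I rate `C√ν` that does NOT extend past `T` eventually has rate `≤ C'√ν` for SOME `C' < 18 − 9√3`, then `NoTypeIBlowup`
(`Theses.TypeICertificateLadder.NoTypeIBlowup` = `ThreadingFlux.Target`, item 1217): the route's `LadderGlue_holds` reduces the crux to all
rungs; at level `C` argue by contradiction, descend to `C'`, raise to `max C' 1 ∈ (0, 18 − 9√3)`, and extend by `rung_of_lt_reach`. [folklore] -/
theorem noTypeIBlowup_of_descent_below_reach
    (hD : ∀ (ν T : ℝ), 0 < ν → 0 < T → ∀ (u : ℝ → EuclideanSpace ℝ (Fin 3) → EuclideanSpace ℝ (Fin 3))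
      (p : ℝ → EuclideanSpace ℝ (Fin 3) → ℝ), IsClassicalNSSolutionOn (Set.Ico 0 T) ν 0 u p →
      IsLerayHopfOn T ν 0 (u 0) u → HasRapidSpatialDecay (u 0) →
      ∀ C : ℝ, (∀ᶠ t in 𝓝[<] T, ∀ x, Real.sqrt (T - t) * ‖u t x‖ ≤ C * Real.sqrt ν) →
      ¬ HasSmoothExtensionPast ν 0 u T →
      ∃ C' : ℝ, C' < 18 - 9 * Real.sqrt 3 ∧ ∀ᶠ t in 𝓝[<] T, ∀ x, Real.sqrt (T - t) * ‖u t x‖ ≤ C' * Real.sqrt ν) :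
    NoTypeIBlowup := by
  refine LadderGlue_holds fun C _ => ?_
  intro ν T hν hT u p hcl hLH hdec hrate
  by_contra hext
  obtain ⟨C', hC', hrate'⟩ := hD ν T hν hT u p hcl hLH hdec C hrate hext
  have hpos : 0 < max C' 1 := lt_max_of_lt_right one_pos
  have hlt : max C' 1 < 18 - 9 * Real.sqrt 3 := max_lt hC' (by linarith [two_lt_reach])
  have hrate'' : ∀ᶠ t in 𝓝[<] T, ∀ x, Real.sqrt (T - t) * ‖u t x‖ ≤ max C' 1 * Real.sqrt ν := by
    filter_upwards [hrate'] with t ht x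
    exact (ht x).trans (mul_le_mul_of_nonneg_right (le_max_left _ _) (Real.sqrt_nonneg ν))
  exact hext (rung_of_lt_reach _ hpos hlt ν T hν hT u p hcl hLH hdec hrate'')

/-- **Converse (no hidden strength): the crux gives descent below the reach vacuously** (a Type-I(`C`) solution IS a Type-I blow-up
candidate, so it extends). [folklore] -/
theorem descent_below_reach_of_noTypeIBlowup (hI : NoTypeIBlowup) :
    ∀ (ν T : ℝ), 0 < ν → 0 < T → ∀ (u : ℝ → EuclideanSpace ℝ (Fin 3) → EuclideanSpace ℝ (Fin 3))
      (p : ℝ → EuclideanSpace ℝ (Fin 3) → ℝ), IsClassicalNSSolutionOn (Set.Ico 0 T) ν 0 u p →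
      IsLerayHopfOn T ν 0 (u 0) u → HasRapidSpatialDecay (u 0) →
      ∀ C : ℝ, (∀ᶠ t in 𝓝[<] T, ∀ x, Real.sqrt (T - t) * ‖u t x‖ ≤ C * Real.sqrt ν) →
      ¬ HasSmoothExtensionPast ν 0 u T →
      ∃ C' : ℝ, C' < 18 - 9 * Real.sqrt 3 ∧ ∀ᶠ t in 𝓝[<] T, ∀ x, Real.sqrt (T - t) * ‖u t x‖ ≤ C' * Real.sqrt ν := by
  intro ν T hν hT u p hcl hLH hdec C hrate hext
  refine absurd (hI ν T hν hT u p hcl hLH hdec ⟨C * Real.sqrt ν, ?_⟩) hext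
  have hlt : ∀ᶠ t in 𝓝[<] T, t < T := self_mem_nhdsWithin
  filter_upwards [hrate, hlt] with t ht htT
  intro x
  have hTt : 0 < Real.sqrt (T - t) := Real.sqrt_pos.2 (sub_pos.2 htT)
  rw [le_div_iff₀ hTt, mul_comm]
  exact ht x

/-- **`NoTypeIBlowup` ⟺ descent from every level to some level below the certified reach `18 − 9√3`.** [folklore] -/
theorem noTypeIBlowup_iff_descent_below_reach :
    NoTypeIBlowup ↔
      ∀ (ν T : ℝ), 0 < ν → 0 < T → ∀ (u : ℝ → EuclideanSpace ℝ (Fin 3) → EuclideanSpace ℝ (Fin 3))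
        (p : ℝ → EuclideanSpace ℝ (Fin 3) → ℝ), IsClassicalNSSolutionOn (Set.Ico 0 T) ν 0 u p →
        IsLerayHopfOn T ν 0 (u 0) u → HasRapidSpatialDecay (u 0) →
        ∀ C : ℝ, (∀ᶠ t in 𝓝[<] T, ∀ x, Real.sqrt (T - t) * ‖u t x‖ ≤ C * Real.sqrt ν) →
        ¬ HasSmoothExtensionPast ν 0 u T →
        ∃ C' : ℝ, C' < 18 - 9 * Real.sqrt 3 ∧ ∀ᶠ t in 𝓝[<] T, ∀ x, Real.sqrt (T - t) * ‖u t x‖ ≤ C' * Real.sqrt ν :=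
  ⟨descent_below_reach_of_noTypeIBlowup, noTypeIBlowup_of_descent_below_reach⟩

end Summit.NavierStokesRegularity.NavierStokesRegularity.Theorems.DepletionLadder.Reach

end
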